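import Summits.QuantumFields.YangMills.Theses.WilsonVillainPerimeterTransfer

/-!
# Assembly of route `WilsonVillainPerimeterTransfer` (planner seat ym-idea-3 g6; route status draft at the time of writing)

The route file's kernel-checked deciding theorem `closes` packaged as the proof of the route's `Assembly` item (stmt-QuantumFields-26974):
the recorded implication from the route's items to the barrier fact `Literature.Barriers.QuantumFields.AbelianDeconfinementD4` (Wilson U(1)₄ perimeter law; NOT the summit conjunct).  No summit, no rung and no crux is proved here; every crux of the route
stays open.  Width seat ym-line-sfw-p2-w2 g20 (cell `ym-idea-1`, free hands).
-/

namespace Summit.QuantumFields.YangMills.Theorems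

open Summit.QuantumFields.YangMills.Theses.WilsonVillainPerimeterTransfer in
/-- The `Assembly` item of route `WilsonVillainPerimeterTransfer` holds: it is the route's deciding theorem `closes` read as an implication. [folklore] -/
theorem wilsonVillainPerimeterTransfer_assembly : Summit.QuantumFields.YangMills.Theses.WilsonVillainPerimeterTransfer.Assembly :=
  fun h₁ h₂ h₃ => closes h₁ h₂ h₃

end Summit.QuantumFields.YangMills.Theorems
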